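import Literature.AlgebraicGeometry.Frobenioids.ArchimedeanF0FSMFactorization
import Literature.AlgebraicGeometry.Frobenioids.ArchimedeanArcPowers
import Literature.AlgebraicGeometry.Frobenioids.ArchimedeanFSMPullbackFSMI
import HarnessLib

/-!
# Frobenioids II, Remark 3.3.1 / Proposition 3.4 (viii) for `A₀`: monomorphisms, the Frobenius part
# of an arrow, and the irreducibility of prime power arrows
# (abc-iut cell, layer L1, node `FrdII:Prop3.4(viii)/P34-L12`, chain LC-L1-2)

Mochizuki, *The geometry of Frobenioids II: poly-Frobenioids*, Kyushu J. Math. **62** (2008)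
401–460, §3, Remark 3.3.1 p. 29 and the proof of Proposition 3.4 (viii), journal p. 427 ll. 31–46
(= kurims p. 32) [cite: MochizukiFrdII2008, Prop 3.4 (viii) p.32]:

> "Next, observe that (by [Mzk5, Proposition 1.7 (ii)], applied to the Frobenioid `A₀`) `φ` admits a
> factorization `φ = α ∘ β`, where `β` is a morphism of Frobenius type, and `α` is an isometric
> pre-step … `β` may be written as a composite `β = β_b ∘ ⋯ ∘ β₁` of prime-Frobenius morphisms …
> each of the `β_j` is a monomorphism (i.e., more concretely: induces an injection on underlying
> angular regions – cf. Remark 3.3.1) … since `β_j` is a prime-Frobenius morphism, it follows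
> immediately from the fact that `β_j` induces a bijection on underlying angular regions that `β_j`
> is irreducible, hence an FSMI-morphism."

PROOF-ONLY file (nothing defined), part 3a of sub-DAG row `P34-L12` (`F0FSMFactorsFSMI`), for the
angular Frobenioid `A₀` of Example 3.3 (iii) between COMPLEX objects:
* Remark 3.3.1 in `A₀`, both directions: `A0.injOn_pow_dir_of_mono` (a monomorphism `(b, d, c)` has
  `z ↦ z^d` injective on the angular part of its domain — narrow test object, two arrows differing by
  a `d`-th root of unity) and `A0.mono_of_injOn_pow_carrier` (injectivity of `a ↦ a^d` on the angular
  region gives a monomorphism);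
* `A0.exists_pow_factor`: `φ = (b, p·m, c)` factors as `β ≫ ψ` through the power object
  `X^{(p)} = (A_X^{⊗p})`, `β = (id, p, 1)`, `ψ = (b, m, c)` (the Frobenius part split off);
* `A0.isIrreducible_powArrow`: for `p` prime and `z ↦ z^p` injective on `B_X`, the power arrow
  `β : X → X^{(p)}` is irreducible (in `β = g ≫ h`: if `deg h = 1`, `h` fills the angular part of its
  codomain; if `deg g = 1`, the `g`-image of `B_X` and the twisted angular part of the middle object
  are nested arcs with the same `p`-th power, hence equal — `NormOne.eq_of_subset_of_pow_subset`).
The assembly (FSMI-chain by induction on `deg_Fr`) is `ArchimedeanF0FSMFactorizationA0.lean`.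
No side is taken on [IUTchIII] Cor. 3.12.
-/

namespace Literature.AlgebraicGeometry.Frobenioids

open CategoryTheory Set
open scoped Pointwise

noncomputable section

namespace ArchFrd

namespace A0

/-- An object of `A₀` mapping to a complex object is complex. [cite: MochizukiFrdII2008, Ex 3.3 (iii) p.28] -/
theorem isComplexObj_of_hom {X Y : A0} (φ : X ⟶ Y) (hY : Y.obj.IsComplexObj) :
    X.obj.IsComplexObj := by
  have b := C0.Base φ.hom
  rw [show Y.obj.base = D0.complex from hY] at b
  exact D0.eq_complex_of_hom_complex b

/-- **Remark 3.3.1 for `A₀`, the direction half**: a monomorphism `φ = (b, d, c)` of `A₀` out of a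
complex object has `z ↦ z^d` injective on the angular part of its domain (two directions with the
same `d`-th power give two distinct arrows from a narrow test object equalised by `φ`).
[cite: MochizukiFrdII2008, Rmk 3.3.1 p.29] -/
theorem injOn_pow_dir_of_mono {X Y : A0} (hX : X.obj.IsComplexObj) (φ : X ⟶ Y) [Mono φ] :
    Set.InjOn (fun z : ↥(normOneSubgroup ℂ) => z ^ (C0.degFr φ.hom : ℕ)) X.obj.region.dir := by
  intro z₁ hz₁ z₂ hz₂ heq
  change z₁ ^ _ = z₂ ^ _ at heq
  by_contra hne
  obtain ⟨ε₁, hε₁, hε₁π, hsub₁⟩ := exists_arcDir_subset X.obj.region.isOpen_dir hz₁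
  obtain ⟨ε₂, hε₂, -, hsub₂⟩ := exists_arcDir_subset X.obj.region.isOpen_dir hz₂
  have hε : 0 < min ε₁ ε₂ := lt_min hε₁ hε₂
  have hεπ : min ε₁ ε₂ < Real.pi := lt_of_le_of_lt (min_le_left _ _) hε₁π
  let W₀ : C0 := ⟨X.obj.base, arcRegion z₁ (min ε₁ ε₂) hε hεπ X.obj.region.tip,
    fun h => D0.noConfusion (h.symm.trans hX)⟩
  let W : A0 := ⟨W₀⟩
  set u : ↥(normOneSubgroup ℂ) := z₂ * z₁⁻¹ with hu
  have hmaps : ∀ w : ↥(normOneSubgroup ℂ), arcDir (w * z₁) (min ε₁ ε₂) ⊆ X.obj.region.dir →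
      (w : ℂˣ) • W₀.region.carrier ^ ((1 : ℕ+) : ℕ) ⊆ C0.pullRegion X.obj (𝟙 X.obj.base) := by
    intro w hw
    rw [PNat.one_coe, pow_one, C0.pullRegion_id]
    intro y hy
    obtain ⟨v, hv, rfl⟩ := Set.mem_smul_set.mp hy
    obtain ⟨hv1, hv2⟩ := (AngularRegion.mem_carrier_polar_iff _ v).1 hv
    refine (AngularRegion.mem_carrier_polar_iff _ _).2 ⟨?_, ?_⟩
    · rw [smul_eq_mul, unitPart_mul, unitPart_normOne_coe]
      exact hw ((mem_arcDir_mul_iff w z₁ _ _).2 hv1)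
    · rw [smul_eq_mul, map_mul, absHom_coe_normOne, one_mul]; exact hv2
  have hsubu : arcDir (u * z₁) (min ε₁ ε₂) ⊆ X.obj.region.dir := by
    rw [hu, inv_mul_cancel_right]
    exact fun v hv => hsub₂ (arcDir_mono _ (min_le_right _ _) hv)
  have hsub1 : arcDir (1 * z₁) (min ε₁ ε₂) ⊆ X.obj.region.dir := by
    rw [one_mul]
    exact fun v hv => hsub₁ (arcDir_mono _ (min_le_left _ _) hv)
  have hwmem : ∀ w : ↥(normOneSubgroup ℂ), (w : ℂˣ) ∈ D0.scalars X.obj.base := fun w => by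
    rw [show X.obj.base = D0.complex from hX]; exact Subgroup.mem_top _
  let a₀ : ∀ w : ↥(normOneSubgroup ℂ), arcDir (w * z₁) (min ε₁ ε₂) ⊆ X.obj.region.dir →
      (W₀ ⟶ X.obj) := fun w hw =>
    { base := 𝟙 _
      degFr := 1
      scalar := (w : ℂˣ)
      scalar_mem := hwmem w
      mapsTo := hmaps w hw }
  have hiso : ∀ w hw, PreFrobenioid.IsIsometry C0.toElem (a₀ w hw) := fun w hw => by
    rw [A0.isIsometry_iff_norm_mul_tip_pow]
    change ‖(((w : ℂˣ)) : ℂ)‖ * (X.obj.region.tip : ℝ) ^ ((1 : ℕ+) : ℕ) = X.obj.tip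
    rw [(mem_normOneSubgroup_iff ℂ _).1 w.2, one_mul, PNat.one_coe, pow_one]; rfl
  let a : ∀ w hw, (W ⟶ X) := fun w hw => ⟨a₀ w hw, hiso w hw⟩
  have heq' : a 1 hsub1 ≫ φ = a u hsubu ≫ φ := by
    refine WideSubcategory.hom_ext _ (C0.hom_ext rfl rfl ?_)
    change (C0.Base (a₀ 1 hsub1)).act (C0.scalar φ.hom) * ((1 : ↥(normOneSubgroup ℂ)) : ℂˣ) ^ _ =
      (C0.Base (a₀ u hsubu)).act (C0.scalar φ.hom) * ((u : ↥(normOneSubgroup ℂ)) : ℂˣ) ^ _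
    have hud : u ^ (C0.degFr φ.hom : ℕ) = 1 := by
      rw [hu, mul_pow, ← heq, ← mul_pow, mul_inv_cancel, one_pow]
    rw [← Subgroup.coe_pow, ← Subgroup.coe_pow, one_pow, hud]
  have := (cancel_mono φ).1 heq'
  have hsc := congrArg (fun k : W ⟶ X => C0.scalar k.hom) this
  change ((1 : ↥(normOneSubgroup ℂ)) : ℂˣ) = ((u : ↥(normOneSubgroup ℂ)) : ℂˣ) at hsc
  have hu1 : u = 1 := (Subtype.ext (Units.ext (congrArg (fun x : ℂˣ => (x : ℂ)) hsc))).symm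
  rw [hu, mul_inv_eq_one] at hu1
  exact hne hu1.symm

/-- **Remark 3.3.1 for `A₀`, converse half**: an arrow `ψ` of `A₀` between complex objects whose
region map `a ↦ c · a^{deg_Fr ψ}` is injective on the angular region of the domain is a monomorphism.
[cite: MochizukiFrdII2008, Rmk 3.3.1 p.29] -/
theorem mono_of_injOn_pow_carrier {P Y : A0} (hP : P.obj.IsComplexObj) (hY : Y.obj.IsComplexObj)
    (ψ : P ⟶ Y) (hinj : Set.InjOn (fun u : ℂˣ => u ^ (C0.degFr ψ.hom : ℕ)) P.obj.region.carrier) :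
    Mono ψ := by
  refine ⟨fun {W} a₁ a₂ h => ?_⟩
  have h' : a₁.hom ≫ ψ.hom = a₂.hom ≫ ψ.hom := congrArg (fun k => InducedWideCategory.Hom.hom k) h
  -- bases
  haveI : IsIso (C0.Base ψ.hom) := D0.isIso_of_isComplex _ hP hY
  have hb : C0.Base a₁.hom = C0.Base a₂.hom := by
    have := congrArg C0.Base h'
    rw [C0.base_comp', C0.base_comp'] at this
    exact (cancel_mono _).1 this
  -- degrees
  have hd : C0.degFr a₁.hom = C0.degFr a₂.hom := by
    have := congrArg C0.degFr h'
    rw [C0.degFr_comp', C0.degFr_comp'] at this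
    exact mul_right_cancel this
  -- scalars
  have hs : C0.scalar a₁.hom ^ (C0.degFr ψ.hom : ℕ) = C0.scalar a₂.hom ^ (C0.degFr ψ.hom : ℕ) := by
    have := congrArg C0.scalar h'
    rw [C0.scalar_comp', C0.scalar_comp', hb] at this
    exact mul_left_cancel this
  obtain ⟨w, hw, -⟩ := C0.exists_mem_boundary W.obj.region
  have hm₁ : C0.scalar a₁.hom • w ^ (C0.degFr a₁.hom : ℕ) ∈ C0.pullRegion P.obj (C0.Base a₁.hom) :=
    a₁.hom.mapsTo (Set.smul_mem_smul_set (Set.pow_mem_pow hw))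
  have hm₂ : C0.scalar a₂.hom • w ^ (C0.degFr a₂.hom : ℕ) ∈ C0.pullRegion P.obj (C0.Base a₂.hom) :=
    a₂.hom.mapsTo (Set.smul_mem_smul_set (Set.pow_mem_pow hw))
  rw [← hb, ← hd] at hm₂
  unfold C0.pullRegion at hm₁ hm₂
  obtain ⟨x₁, hx₁, hx₁e⟩ := hm₁
  obtain ⟨x₂, hx₂, hx₂e⟩ := hm₂
  have hx : x₁ ^ (C0.degFr ψ.hom : ℕ) = x₂ ^ (C0.degFr ψ.hom : ℕ) := by
    apply (C0.Base a₁.hom).act.injective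
    rw [map_pow, map_pow, hx₁e, hx₂e, smul_eq_mul, smul_eq_mul, mul_pow, mul_pow, hs]
  have hx12 : x₁ = x₂ := hinj hx₁ hx₂ hx
  have hsc : C0.scalar a₁.hom = C0.scalar a₂.hom := by
    have : C0.scalar a₁.hom • w ^ (C0.degFr a₁.hom : ℕ) = C0.scalar a₂.hom • w ^ (C0.degFr a₁.hom : ℕ) := by
      rw [← hx₁e, ← hx₂e, hx12]
    rw [smul_eq_mul, smul_eq_mul] at this
    exact mul_right_cancel this
  exact WideSubcategory.hom_ext _ (C0.hom_ext hb hd hsc)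

/-- The isometry condition of an arrow of `A₀` in coordinates: `|c| · tip(A_X)^{deg_Fr} = tip(A_Y)`.
[cite: MochizukiFrdII2008, Ex 3.3 (iii) p.28] -/
theorem norm_mul_tip_pow {X Y : A0} (φ : X ⟶ Y) :
    ‖(C0.scalar φ.hom : ℂ)‖ * X.obj.tip ^ (C0.degFr φ.hom : ℕ) = Y.obj.tip :=
  (A0.isIsometry_iff_norm_mul_tip_pow φ.hom).1 φ.property

/-- **The Frobenius part of an arrow of `A₀`, split off** ([FrdI] Prop. 1.7 (ii) in `A₀`): an arrow
`φ = (b, p·m, c) : X → Y` out of a complex object factors as `φ = β ≫ ψ` through the object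
`X^{(p)} := (Spec L, A_X^{⊗p})` (angular part `B_X^p`, tip `tip(A_X)^p`), with `β = (id, p, 1)` the
`p`-th power arrow and `ψ = (b, m, c)`. [cite: MochizukiFrdII2008, Prop 3.4 (viii) p.32] -/
theorem exists_pow_factor {X Y : A0} (hX : X.obj.IsComplexObj) (φ : X ⟶ Y) (p m : ℕ+)
    (hpm : p * m = C0.degFr φ.hom) :
    ∃ (P : A0) (β : X ⟶ P) (ψ : P ⟶ Y), β ≫ ψ = φ ∧ P.obj.IsComplexObj ∧
      P.obj.region.dir = X.obj.region.dir ^ (p : ℕ) ∧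
      P.obj.region.carrier = X.obj.region.carrier ^ (p : ℕ) ∧
      C0.degFr β.hom = p ∧ C0.scalar β.hom = 1 ∧ D0.Hom.twists (C0.Base β.hom) = false ∧
      C0.degFr ψ.hom = m ∧ C0.scalar ψ.hom = C0.scalar φ.hom ∧
      D0.Hom.twists (C0.Base ψ.hom) = D0.Hom.twists (C0.Base φ.hom) := by
  obtain ⟨R, hRd, hRt⟩ := exists_angularRegion (isOpen_pow X.obj.region.isOpen_dir p.natPred)
    (isConnected_pow X.obj.region.isConnected_dir p.natPred) (X.obj.region.tip ^ (p : ℕ))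
  rw [p.natPred_add_one] at hRd
  have hRc : R.carrier = X.obj.region.carrier ^ (p : ℕ) := by
    ext u
    rw [AngularRegion.mem_carrier_polar_iff, ← p.natPred_add_one, AngularRegion.mem_carrier_pow_iff,
      p.natPred_add_one, hRd, hRt]
  let P₀ : C0 := ⟨X.obj.base, R, fun h => D0.noConfusion (h.symm.trans hX)⟩
  let P : A0 := ⟨P₀⟩
  let β₀ : X.obj ⟶ P₀ :=
    { base := 𝟙 _
      degFr := p
      scalar := 1
      scalar_mem := one_mem _
      mapsTo := by
        rw [one_smul, C0.pullRegion_id]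
        exact hRc.symm.subset }
  let ψ₀ : P₀ ⟶ Y.obj :=
    { base := φ.hom.base
      degFr := m
      scalar := C0.scalar φ.hom
      scalar_mem := φ.hom.scalar_mem
      mapsTo := by
        have h : C0.scalar φ.hom • X.obj.region.carrier ^ ((p * m : ℕ+) : ℕ) ⊆
            C0.pullRegion Y.obj φ.hom.base := by
          rw [hpm]; exact φ.hom.mapsTo
        rw [PNat.mul_coe, pow_mul, ← hRc] at h
        exact h }
  have htipP : P₀.tip = X.obj.tip ^ (p : ℕ) := by
    change (R.tip : ℝ) = (X.obj.region.tip : ℝ) ^ (p : ℕ)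
    rw [hRt, Positive.val_pow]
  have hβiso : PreFrobenioid.IsIsometry C0.toElem β₀ := by
    rw [A0.isIsometry_iff_norm_mul_tip_pow]
    change ‖((1 : ℂˣ) : ℂ)‖ * X.obj.tip ^ (p : ℕ) = P₀.tip
    rw [Units.val_one, norm_one, one_mul, htipP]
  have hψiso : PreFrobenioid.IsIsometry C0.toElem ψ₀ := by
    rw [A0.isIsometry_iff_norm_mul_tip_pow]
    change ‖(C0.scalar φ.hom : ℂ)‖ * P₀.tip ^ (m : ℕ) = Y.obj.tip
    rw [htipP, ← pow_mul, ← PNat.mul_coe, hpm]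
    exact norm_mul_tip_pow φ
  have htwβ : D0.Hom.twists (C0.Base β₀) = false := D0.twists_id _
  have htwψ : D0.Hom.twists (C0.Base ψ₀) = D0.Hom.twists (C0.Base φ.hom) := by rfl
  refine ⟨P, ⟨β₀, hβiso⟩, ⟨ψ₀, hψiso⟩, ?_, hX, hRd, hRc, rfl, rfl, htwβ, rfl, rfl, htwψ⟩
  refine WideSubcategory.hom_ext _ (C0.hom_ext (Category.id_comp φ.hom.base) hpm ?_)
  change D0.Hom.act (𝟙 X.obj.base) (C0.scalar φ.hom) * (1 : ℂˣ) ^ (m : ℕ) = C0.scalar φ.hom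
  rw [one_pow, mul_one]
  unfold D0.Hom.act
  rw [D0.twists_id, D0.galAct_false]

end A0

/-! ### Twist bookkeeping -/

namespace C0

/-- Twists add under composition into a complex object. [cite: MochizukiFrdII2008, §3 p.23] -/
theorem twists_comp_eq_xor_of_eq_complex {M L K : D0} (f : M ⟶ L) (g : L ⟶ K) (hK : K = D0.complex) :
    D0.Hom.twists (f ≫ g) = xor (D0.Hom.twists f) (D0.Hom.twists g) := by
  subst hK; exact D0.twists_comp_complex f g

/-- The twist of the inverse is the inverse of the twist. [cite: MochizukiFrdII2008, Def 3.1 (iv) p.24] -/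
theorem twist_inv {L K : D0} (f : L ⟶ K) (z : ↥(normOneSubgroup ℂ)) :
    unitPart ℂ (f.act ((z⁻¹ : ↥(normOneSubgroup ℂ)) : ℂˣ)) = (unitPart ℂ (f.act (z : ℂˣ)))⁻¹ := by
  apply eq_inv_of_mul_eq_one_left
  rw [← twist_mul, inv_mul_cancel, OneMemClass.coe_one, map_one, unitPart_one]

/-- Powers of translates: `(w · B)^n = w^n · B^n`. [cite: MochizukiFrdII2008, Def 3.1 (iii) p.24] -/
theorem smul_set_pow_normOne (w : ↥(normOneSubgroup ℂ)) (B : Set ↥(normOneSubgroup ℂ)) :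
    ∀ n : ℕ, (w • B) ^ (n + 1) = w ^ (n + 1) • B ^ (n + 1)
  | 0 => by rw [zero_add, pow_one, pow_one, pow_one]
  | n + 1 => by
    rw [pow_succ, smul_set_pow_normOne w B n, pow_succ _ (n + 1), pow_succ _ (n + 1)]
    ext x
    simp only [Set.mem_mul, Set.mem_smul_set, smul_eq_mul]
    constructor
    · rintro ⟨_, ⟨y, hy, rfl⟩, _, ⟨z, hz, rfl⟩, rfl⟩
      exact ⟨y * z, ⟨y, hy, z, hz, rfl⟩, mul_mul_mul_comm _ _ _ _⟩
    · rintro ⟨_, ⟨y, hy, z, hz, rfl⟩, rfl⟩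
      exact ⟨_, ⟨y, hy, rfl⟩, _, ⟨z, hz, rfl⟩, (mul_mul_mul_comm _ _ _ _).symm⟩

end C0

namespace A0

/-- **The `p`-th power arrow is irreducible** ("since `β_j` is a prime-Frobenius morphism, it follows
immediately from the fact that `β_j` induces a bijection on underlying angular regions that `β_j` is
irreducible", proof of Prop. 3.4 (viii)): for `β = (id, p, 1) : X → X^{(p)}` with `p` prime and
`z ↦ z^p` injective on `B_X`, in any factorisation `β = g ≫ h` one of `g`, `h` is an isomorphism —
if `deg_Fr(h) = 1` the angular part of the middle object is filled by `h⁻¹`-twisting `B_X^p`; if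
`deg_Fr(g) = 1` the middle angular part contains the `g`-image of `B_X` and has the same `p`-th
power, so coincides with it (nested arcs with equal powers). [cite: MochizukiFrdII2008, Prop 3.4 (viii) p.32] -/
theorem isIrreducible_powArrow {X P : A0} (hX : X.obj.IsComplexObj) (hP : P.obj.IsComplexObj)
    (β : X ⟶ P) {p : ℕ} (hp : p.Prime) (hdeg : (C0.degFr β.hom : ℕ) = p) (hsc : C0.scalar β.hom = 1)
    (htw : D0.Hom.twists (C0.Base β.hom) = false)
    (hPd : P.obj.region.dir = X.obj.region.dir ^ p)
    (hinj : Set.InjOn (fun z : ↥(normOneSubgroup ℂ) => z ^ p) X.obj.region.dir) :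
    IsIrreducibleHom β := by
  refine ⟨fun hiso => ?_, fun M g h hfac => ?_⟩
  · haveI : IsIso β.hom := ⟨⟨(inv β).hom, congrArg InducedWideCategory.Hom.hom (IsIso.hom_inv_id β),
      congrArg InducedWideCategory.Hom.hom (IsIso.inv_hom_id β)⟩⟩
    have h1 := (C0.of_isIso β.hom).2.1
    have : p = 1 := by rw [← hdeg, h1]; rfl
    exact hp.one_lt.ne' this
  have hM : M.obj.IsComplexObj := isComplexObj_of_hom h hP
  have hfacC : g.hom ≫ h.hom = β.hom := congrArg InducedWideCategory.Hom.hom hfac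
  haveI : IsIso (C0.Base g.hom) := D0.isIso_of_isComplex _ hX hM
  haveI : IsIso (C0.Base h.hom) := D0.isIso_of_isComplex _ hM hP
  -- degrees
  have hdegs : (C0.degFr g.hom : ℕ) * (C0.degFr h.hom : ℕ) = p := by
    have := congrArg C0.degFr hfacC
    rw [C0.degFr_comp'] at this
    rw [← hdeg, ← this, PNat.mul_coe]
  -- twists: both factors twist alike
  have htws : D0.Hom.twists (C0.Base h.hom) = D0.Hom.twists (C0.Base g.hom) := by
    have h1 := congrArg C0.Base hfacC
    rw [C0.base_comp'] at h1
    have h2 := congrArg D0.Hom.twists h1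
    rw [C0.twists_comp_eq_xor_of_eq_complex _ _ hP, htw] at h2
    revert h2
    cases D0.Hom.twists (C0.Base g.hom) <;> cases D0.Hom.twists (C0.Base h.hom) <;> simp
  have hact : ∀ u : ℂˣ, (C0.Base h.hom).act u = (C0.Base g.hom).act u := fun u => by
    change D0.galAct _ u = D0.galAct _ u; rw [htws]
  -- the common twist on directions
  set T : ↥(normOneSubgroup ℂ) → ↥(normOneSubgroup ℂ) :=
    fun z => unitPart ℂ ((C0.Base g.hom).act (z : ℂˣ)) with hT
  have hTh : (fun z : ↥(normOneSubgroup ℂ) => unitPart ℂ ((C0.Base h.hom).act (z : ℂˣ))) = T := by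
    funext z; rw [hT, hact]
  have hTT : ∀ B : Set ↥(normOneSubgroup ℂ), T '' (T '' B) = B := fun B => by
    rw [Set.image_image]
    conv_rhs => rw [← Set.image_id B]
    exact Set.image_congr fun z _ => C0.twist_twist _ z
  -- scalars: `g(c_h) · c_g^{deg h} = 1`, on unit parts `T(u_h) · u_g^{deg h} = 1`
  have hscal : (C0.Base g.hom).act (C0.scalar h.hom) * C0.scalar g.hom ^ (C0.degFr h.hom : ℕ) = 1 := by
    have := congrArg C0.scalar hfacC
    rw [C0.scalar_comp'] at this
    rw [this, hsc]
  have hunit : T (unitPart ℂ (C0.scalar h.hom)) * unitPart ℂ (C0.scalar g.hom) ^ (C0.degFr h.hom : ℕ) = 1 := by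
    have := congrArg (unitPart ℂ) hscal
    rw [unitPart_mul, C0.unitPart_pow_eq, unitPart_one, C0.unitPart_galAct] at this
    exact this
  -- direction containments of the two factors
  obtain ⟨Ag, hAgc, hAgt, hAgd, -⟩ := exists_pulledRegion M.obj (C0.Base g.hom)
  obtain ⟨Ah, hAhc, hAht, hAhd, -⟩ := exists_pulledRegion P.obj (C0.Base h.hom)
  have hgdir := (C0.hom_conditions g.hom hAgc).1
  have hhdir := (C0.hom_conditions h.hom hAhc).1
  rw [hTh, hPd] at hAhd
  -- case split on the prime degree
  have hdvd : (C0.degFr h.hom : ℕ) ∣ p := ⟨C0.degFr g.hom, by rw [mul_comm]; exact hdegs.symm⟩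
  rcases (Nat.dvd_prime hp).1 hdvd with hh1 | hhp
  · -- `deg h = 1`, `deg g = p`: `h` is an isomorphism
    left
    have hgp : (C0.degFr g.hom : ℕ) = p := by rw [hh1, mul_one] at hdegs; exact hdegs
    have hh1' : C0.degFr h.hom = 1 := PNat.coe_inj.mp hh1
    rw [hgp, hAgd] at hgdir
    -- `T(B_X^p) ⊆ (T u_g)⁻¹ · B_M`, and `(T u_g)⁻¹ = u_h`
    have h1 : T '' (X.obj.region.dir ^ p) ⊆ (T (unitPart ℂ (C0.scalar g.hom)))⁻¹ • M.obj.region.dir := by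
      rw [← Set.smul_set_subset_iff_subset_inv_smul_set, ← C0.twist_image_smul, ← hTT M.obj.region.dir]
      exact Set.image_mono hgdir
    rw [hh1, pow_one] at hunit
    have h2 : (T (unitPart ℂ (C0.scalar g.hom)))⁻¹ = unitPart ℂ (C0.scalar h.hom) := by
      have h3 : unitPart ℂ (C0.scalar g.hom) = (T (unitPart ℂ (C0.scalar h.hom)))⁻¹ :=
        eq_inv_of_mul_eq_one_right hunit
      rw [h3]
      change (unitPart ℂ ((C0.Base g.hom).act
        (((unitPart ℂ ((C0.Base g.hom).act ((unitPart ℂ (C0.scalar h.hom) : ↥(normOneSubgroup ℂ)) : ℂˣ)))⁻¹ :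
          ↥(normOneSubgroup ℂ)) : ℂˣ)))⁻¹ = _
      rw [C0.twist_inv, inv_inv]
      exact C0.twist_twist _ _
    rw [h2] at h1
    haveI : IsIso h.hom :=
      C0.isIso_of_isometry_of_dir h.hom ⟨hh1', (C0.isBaseIso_iff _).mpr inferInstance⟩ h.property
        hAhc hAht (by rw [hAhd]; exact h1)
    exact isIso_of_isIso_hom h
  · -- `deg h = p`, `deg g = 1`: `g` is an isomorphism
    right
    have hg1 : (C0.degFr g.hom : ℕ) = 1 := by
      rw [hhp] at hdegs; exact (mul_eq_right₀ hp.ne_zero).1 hdegs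
    have hg1' : C0.degFr g.hom = 1 := PNat.coe_inj.mp hg1
    rw [hg1, pow_one, hAgd] at hgdir
    rw [hhp] at hhdir hunit
    -- the nested arcs `B₁ = u_g · B_X ⊆ B₂ = T(B_M)` have the same `p`-th power
    obtain ⟨n, hn⟩ : ∃ n, p = n + 1 := ⟨p - 1, (Nat.succ_pred_eq_of_pos hp.pos).symm⟩
    have hpow : (T '' M.obj.region.dir) ^ p ⊆ (unitPart ℂ (C0.scalar g.hom) • X.obj.region.dir) ^ p := by
      have h1 : T (unitPart ℂ (C0.scalar h.hom)) • (T '' M.obj.region.dir) ^ p ⊆ X.obj.region.dir ^ p := by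
        rw [hn, ← C0.twist_image_pow, ← C0.twist_image_smul, ← hn, ← hTT (X.obj.region.dir ^ p), ← hAhd]
        exact Set.image_mono hhdir
      rw [Set.smul_set_subset_iff_subset_inv_smul_set, eq_inv_of_mul_eq_one_left hunit, inv_inv] at h1
      rw [hn, C0.smul_set_pow_normOne, ← hn]
      exact h1
    have hinj₁ : Set.InjOn (fun z : ↥(normOneSubgroup ℂ) => z ^ p)
        (unitPart ℂ (C0.scalar g.hom) • X.obj.region.dir) := by
      rintro _ ⟨x₁, hx₁, rfl⟩ _ ⟨x₂, hx₂, rfl⟩ heq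
      have heq' : x₁ ^ p = x₂ ^ p := by
        have := heq
        simp only [smul_eq_mul, mul_pow] at this
        exact mul_left_cancel this
      change unitPart ℂ (C0.scalar g.hom) • x₁ = unitPart ℂ (C0.scalar g.hom) • x₂
      rw [hinj hx₁ hx₂ heq']
    have hB : unitPart ℂ (C0.scalar g.hom) • X.obj.region.dir = T '' M.obj.region.dir :=
      NormOne.eq_of_subset_of_pow_subset (isConnected_smul _ X.obj.region.isConnected_dir)
        (isOpen_smul _ X.obj.region.isOpen_dir) (hAgd ▸ Ag.isConnected_dir) (hAgd ▸ Ag.isOpen_dir)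
        hgdir hp.pos hinj₁ hpow
    haveI : IsIso g.hom :=
      C0.isIso_of_isometry_of_dir g.hom ⟨hg1', (C0.isBaseIso_iff _).mpr inferInstance⟩ g.property
        hAgc hAgt (by rw [hAgd, ← hB])
    exact isIso_of_isIso_hom g

end A0

end ArchFrd

end

end Literature.AlgebraicGeometry.Frobenioids
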